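import Literature.NumberTheory.LFunctions.WeilTwoPrimeOddMarginHBase
import Literature.NumberTheory.LFunctions.WeilBlockRowsPZ
import Literature.NumberTheory.LFunctions.WeilBlockRowsFast
import HarnessLib

/-!
# Two-prime odd-margin certificate H: the Bessel block claim `Hp = C H Cᵀ`, rows 123–125

`WeilCert.checkHpRow` for certificate H (the exact Legendre cancellation `C H Cᵀ = diag(2a₀/(4i+3))`), by the linear-traversal check `WeilCert.checkHpRowT` (`decide +kernel`) and `checkHpRow_of_T`. Pure proof file.
-/

noncomputable section

namespace Literature.NumberTheory.LFunctions

set_option maxHeartbeats 0 in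
/-- Row 123 of `C H Cᵀ` is row 123 of `Hp` (certificate H). [folklore] -/
theorem checkHpRow1_123_weilCert23H : weilCert23HBase.checkHpRow weilCert23HHp 1 123 = true :=
  WeilCert.checkHpRow_of_T (by decide +kernel : weilCert23HBase.checkHpRowT weilCert23HHp 1 123 = true)

set_option maxHeartbeats 0 in
/-- Row 124 of `C H Cᵀ` is row 124 of `Hp` (certificate H). [folklore] -/
theorem checkHpRow1_124_weilCert23H : weilCert23HBase.checkHpRow weilCert23HHp 1 124 = true :=
  WeilCert.checkHpRow_of_T (by decide +kernel : weilCert23HBase.checkHpRowT weilCert23HHp 1 124 = true)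

set_option maxHeartbeats 0 in
/-- Row 125 of `C H Cᵀ` is row 125 of `Hp` (certificate H). [folklore] -/
theorem checkHpRow1_125_weilCert23H : weilCert23HBase.checkHpRow weilCert23HHp 1 125 = true :=
  WeilCert.checkHpRow_of_T (by decide +kernel : weilCert23HBase.checkHpRowT weilCert23HHp 1 125 = true)


end Literature.NumberTheory.LFunctions
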